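import Summits.QuantumFields.BalabanUV.Beta.GAN24.AffineUnroll
import Summits.QuantumFields.BalabanUV.Beta.GAN24.WSlotT2OfPieces

/-!
# `BalabanUV.Beta.GAN24.T2HybridCells` — binder row G-an2-4 / (CONV-C), W-slot CT-W (the OWNER's `CT-W-DESIGN-v0` §2 (R-HYB) + (R-CT)): **THE DRESSED `T₂` TOWER
# IS AN AFFINE TOWER FOR THE UNDRESSED TRANSPORT WITH SOURCES «source + CELL»** — the contact term of the hybrid split as a level sum of UNDRESSED transports
# of the one-step DRESSING CELLS `cell_l := (𝒜^E_l − 𝒜^B_l) T̃_l`, and road «W3»'s two ENDs fed by PER-LEVEL cell rows (no uniform-in-`n` contact hypothesis,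
# no bound on any dressed composite transport)

NOT IN PRINT; OUR BOOKKEEPING ([folklore] algebra over leaf-01's `AffineUnroll` + the row OWNER's `WSlotT2OfPieces` ENDs; G-an2-4 formalisation swarm,
leaf prover `b2b-balaban-gan24-formalise-leaf-01`, gen 62; OFFER O-leaf01-g62-1, journal l.37593; module name PROVISIONAL — the row owner may rename ∕
re-home it).  HONEST FRAMING (cell contract, verbatim): «discharging `BetaPertH` makes Bałaban's UV stability UNCONDITIONAL — a real constructive-QFT
result; it is NOT the continuum limit and NOT the Clay problem.»  HONEST DEPENDENCY (verbatim): «continuum YM on T⁴ ⇐ BetaPertH ∧ nine spine estimates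
(0/9 proved); BetaPertH ⇐ (D1) ∧ (D4) ∧ CAP+tail; G-an2-4 gates asym, D1 and NE2/3/4.»

## What (and why this shape)

gan24-p2 g35's hybrid split (`T2RecHybridSplit`, (R-HYB)) writes the dressed unit tower `x_n` (recursion `x_{j+1} = A_j x_j + b_j`, `A_j` = the DRESSED
one-step transport) as `x_n = T^{hyb}_n + CONTACT_n` with `T^{hyb}` the `B`-tower (UNDRESSED transport of record) on the same sources and
`CONTACT_n = [𝒯^A − 𝒯^B](0,n) x_0 + Σ_{i<n} [𝒯^A − 𝒯^B](i+1, n−1−i) b_i`, and feeds road W3's END #1 with a UNIFORM contact row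
`hct : ∀ n, LocStencil₂ (CONTACT_n) C_ct δ_T`.  THIS FILE records the «`B` above, member below» form of the same object:

* §1 (generic additive group; maps additive on a class `P ∋ 0` closed under `±`, preserved by both families):
  `rec_of_cell` — `x_{j+1} = B_j x_j + (b_j + cell_j)`, `cell_j := A_j x_j − B_j x_j` (the dressed tower IS a `B`-affine tower);
  `eq_transportB_add_sum_cell` — `x_n = 𝒯^B(0,n) x_0 + Σ_{m<n} 𝒯^B(m+1, n−1−m) (b_m + cell_m)` (leaf-01's `eq_transport_add_sum` for `B`);
  `eq_transportB_add_sum_add_sum_cell` — the same with the two level sums separated;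
  **`contact_eq_sum_transport_cell`** — `CONTACT_n = Σ_{m<n} 𝒯^B(m+1, n−1−m) cell_m` (p2's contact literal, token for token, as a level sum of
  UNDRESSED transports of the cells: above the cell sits the transport of record only);
  `diff_eq_transportB_add_sum_cell` — the difference tower `x_{n+1} − x_n` unrolled through the SHIFTED `B`-transport with forcing
  `(B_{m+1} − B_m) x_m + (b_{m+1} − b_m) + (cell_{m+1} − cell_m)` (leaf-01's `diff_eq_transport_add_sum` for `B`).
* §1b (the OWNER g23's (R-DEV), ruling R-gan24p1-g23-1 l.37889): `dev_rec` ∕ `dev_rec'` (the DEVIATION `x − y` of a dressed and an undressed affine tower is an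
  affine tower for the dressed transport forced by `g′_m := (A_m − B_m) y_m + (b_m − b′_m)` — the UNDRESSED member and the source difference only — or for the
  undressed transport forced through the dressed member's cell), `dev_eq_transport_add_sum`, **`dev_eq_sum_transport_of_eq_zero`** (`x_0 = y_0 ⇒ x_n − y_n =
  Σ_{m<n} 𝒯^A(m+1,n−1−m) g′_m`).
* §2 (generic `d`, the OWNER's END binder shapes verbatim): **`shape_of_cell_rows`** — END #1 `WSlotT2OfPieces.shape_of_rows` with a SECOND source family:
  if `T n = P 0 n (T 0) + Σ P (i+1) (n−1−i) (b i) + Σ P (i+1) (n−1−i) (c i)` and `b`, `c` both carry the (F4)∕(F2) rows (`LocStencil₂ · C δin ∧ mom ≤ C`,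
  `Zfree`), then `LocStencil₂ (T n) (CT·C₀ + CT′·(Cb + Cc)·(1−ρ)⁻¹) δT`; **`rate_of_cell_rows`** — END #2 `rate_of_rows` with a second forcing family
  (`Cf·θ^m` and `Cg·θ^m`, both `Zfree`): `∃ c ϑ, 0 ≤ c ∧ 0 < ϑ < 1 ∧ ∀ n, LocStencil₂ (D n) (c·ϑ^n) δT`.
So «T2Shape»(E) ⟸ [W3's F3 rows for the UNDRESSED transport, TREE at `d = 3` (`TransportRows`)] ∧ [(F4)+(F2) for the sources] ∧ [PER-LEVEL cell rows:
`LocStencil₂ (cell_l) Cc δin`, `mom (cell_l) ≤ Cc`, `Zfree (cell_l)`] — CT-W2∕CT-W3's deliverable in this currency (the cell's envelope must come from the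
slot-divergence identities of `T̃_l`, NOT from `T̃_l`'s own envelope, or the count is circular; located remark R-leaf01-g62-1, journal l.37593).
Asserts NO shape of Bałaban's tables; every row above is a HYPOTHESIS here; discharges NOTHING of «T2Shape» ∕ «T2Drift» ∕ (hW, hWall); NOT «W-slot closed»,
NEVER «G-an2-4 closed» as (CONV-C); NOT D1, NOT `BetaPertH`, NOT continuum, NOT Clay.  0 cited facts, 0 `def`, 0 `def … : Prop`, 0 sorry.
-/

noncomputable section

open Finset
open scoped BigOperators
open Literature.MathematicalPhysics.QuantumFieldTheory
open Literature.MathematicalPhysics.QuantumFieldTheory.Balaban1983to89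
open Literature.MathematicalPhysics.QuantumFieldTheory.Balaban1983to89.Beta
open ExpKernelCalculus (MKer)
open OneStepResolventKernel (Fib)
open BalabanCompositeJets (LocStencil₂)
open Summit.QuantumFields.BalabanUV.Beta.GAN24.AffineUnroll
open Summit.QuantumFields.BalabanUV.Beta.GAN24.WSlotT2OfPieces (locStencil₂_add locStencil₂_mono locStencil₂_sum geom_reflect_sum_le
  exists_geom_dominate conv_sum_le)

namespace Summit.QuantumFields.BalabanUV.Beta.GAN24.T2HybridCells

/-! ## §1 Generic: the dressed tower as a `B`-affine tower with sources «source + cell» -/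

section Generic

variable {E : Type*} [AddCommGroup E] {A B : ℕ → E → E} {P : E → Prop}

/-- [folklore] **THE DRESSED TOWER IS A `B`-AFFINE TOWER**: `x_{j+1} = A_j x_j + b_j = B_j x_j + (b_j + (A_j x_j − B_j x_j))`, for ANY second family `B`. -/
theorem rec_of_cell (B : ℕ → E → E) {x b : ℕ → E} (hrec : ∀ j, x (j + 1) = A j (x j) + b j) (j : ℕ) :
    x (j + 1) = B j (x j) + (b j + (A j (x j) - B j (x j))) := by
  rw [hrec j]; abel

/-- [folklore] Class membership of the cell sources `b_j + (A_j x_j − B_j x_j)` along an `A`-tower started and sourced in the class. -/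
theorem cellSource_mem (hPadd : ∀ x y, P x → P y → P (x + y)) (hPsub : ∀ x y, P x → P y → P (x - y))
    (hAP : ∀ j x, P x → P (A j x)) (hBP : ∀ j x, P x → P (B j x)) {x b : ℕ → E} (hx0 : P (x 0)) (hb : ∀ j, P (b j))
    (hrec : ∀ j, x (j + 1) = A j (x j) + b j) (j : ℕ) : P (b j + (A j (x j) - B j (x j))) :=
  hPadd _ _ (hb j) (hPsub _ _ (hAP _ _ (mem_of_rec hPadd hAP hx0 hb hrec j)) (hBP _ _ (mem_of_rec hPadd hAP hx0 hb hrec j)))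

/-- [folklore] **THE DRESSED TOWER UNROLLED THROUGH THE UNDRESSED TRANSPORT**: `x_n = 𝒯^B(0,n) x_0 + Σ_{m<n} 𝒯^B(m+1, n−1−m) (b_m + cell_m)`,
`cell_m := A_m x_m − B_m x_m` (leaf-01's `AffineUnroll.eq_transport_add_sum` for the family `B` on the recursion `rec_of_cell`; `B` additive on the class). -/
theorem eq_transportB_add_sum_cell (hP0 : P 0) (hPadd : ∀ x y, P x → P y → P (x + y)) (hPsub : ∀ x y, P x → P y → P (x - y))
    (hAP : ∀ j x, P x → P (A j x)) (hBP : ∀ j x, P x → P (B j x)) (hBadd : ∀ j x y, P x → P y → B j (x + y) = B j x + B j y)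
    {x b : ℕ → E} (hx0 : P (x 0)) (hb : ∀ j, P (b j)) (hrec : ∀ j, x (j + 1) = A j (x j) + b j) (n : ℕ) :
    x n = transport B 0 n (x 0) + ∑ m ∈ Finset.range n, transport B (m + 1) (n - 1 - m) (b m + (A m (x m) - B m (x m))) :=
  eq_transport_add_sum (A := B) (P := P) hP0 hPadd hBP hBadd hx0 (cellSource_mem hPadd hPsub hAP hBP hx0 hb hrec) (rec_of_cell B hrec) n

/-- [folklore] **THE SAME WITH THE TWO LEVEL SUMS SEPARATED**: `x_n = 𝒯^B(0,n) x_0 + Σ_{m<n} 𝒯^B(m+1,n−1−m) b_m + Σ_{m<n} 𝒯^B(m+1,n−1−m) cell_m`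
(additivity of the `B`-transport on the class, `AffineUnroll.transport_add`). -/
theorem eq_transportB_add_sum_add_sum_cell (hP0 : P 0) (hPadd : ∀ x y, P x → P y → P (x + y)) (hPsub : ∀ x y, P x → P y → P (x - y))
    (hAP : ∀ j x, P x → P (A j x)) (hBP : ∀ j x, P x → P (B j x)) (hBadd : ∀ j x y, P x → P y → B j (x + y) = B j x + B j y)
    {x b : ℕ → E} (hx0 : P (x 0)) (hb : ∀ j, P (b j)) (hrec : ∀ j, x (j + 1) = A j (x j) + b j) (n : ℕ) :
    x n = transport B 0 n (x 0) + ∑ m ∈ Finset.range n, transport B (m + 1) (n - 1 - m) (b m) +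
      ∑ m ∈ Finset.range n, transport B (m + 1) (n - 1 - m) (A m (x m) - B m (x m)) := by
  have hxP : ∀ j, P (x j) := mem_of_rec hPadd hAP hx0 hb hrec
  rw [eq_transportB_add_sum_cell hP0 hPadd hPsub hAP hBP hBadd hx0 hb hrec n, add_assoc, ← Finset.sum_add_distrib]
  congr 1
  refine Finset.sum_congr rfl fun m _ => ?_
  exact transport_add hBP hBadd _ _ (hb m) (hPsub _ _ (hAP _ _ (hxP m)) (hBP _ _ (hxP m)))

/-- [folklore] **THE CONTACT TERM OF THE HYBRID SPLIT IS THE LEVEL SUM OF UNDRESSED TRANSPORTS OF THE CELLS**: with p2 g35's contact literal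
(`T2RecHybridSplit.eq_hyb_add_contact`: `[𝒯^A − 𝒯^B](0,n) x_0 + Σ_{m<n} ([𝒯^A − 𝒯^B](m+1, n−1−m) b_m)`),
`CONTACT_n = Σ_{m<n} 𝒯^B(m+1, n−1−m) (A_m x_m − B_m x_m)` — above each cell sits the UNDRESSED transport only; below it, the dressed member `x_m` itself
(the «`B` above, member below» Duhamel; cf. leaf-06 g42's `TransportTelescope.transport_sub_transport′`).  `A` and `B` additive on the class. -/
theorem contact_eq_sum_transport_cell (hP0 : P 0) (hPadd : ∀ x y, P x → P y → P (x + y)) (hPsub : ∀ x y, P x → P y → P (x - y))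
    (hAP : ∀ j x, P x → P (A j x)) (hBP : ∀ j x, P x → P (B j x)) (hAadd : ∀ j x y, P x → P y → A j (x + y) = A j x + A j y)
    (hBadd : ∀ j x y, P x → P y → B j (x + y) = B j x + B j y)
    {x b : ℕ → E} (hx0 : P (x 0)) (hb : ∀ j, P (b j)) (hrec : ∀ j, x (j + 1) = A j (x j) + b j) (n : ℕ) :
    (transport A 0 n (x 0) - transport B 0 n (x 0)) +
        ∑ m ∈ Finset.range n, (transport A (m + 1) (n - 1 - m) (b m) - transport B (m + 1) (n - 1 - m) (b m)) =
      ∑ m ∈ Finset.range n, transport B (m + 1) (n - 1 - m) (A m (x m) - B m (x m)) := by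
  have hA := eq_transport_add_sum (A := A) (P := P) hP0 hPadd hAP hAadd hx0 hb hrec n
  have hB := eq_transportB_add_sum_add_sum_cell hP0 hPadd hPsub hAP hBP hBadd hx0 hb hrec n
  calc (transport A 0 n (x 0) - transport B 0 n (x 0)) +
        ∑ m ∈ Finset.range n, (transport A (m + 1) (n - 1 - m) (b m) - transport B (m + 1) (n - 1 - m) (b m))
      = (transport A 0 n (x 0) + ∑ m ∈ Finset.range n, transport A (m + 1) (n - 1 - m) (b m)) -
          (transport B 0 n (x 0) + ∑ m ∈ Finset.range n, transport B (m + 1) (n - 1 - m) (b m)) := by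
        rw [Finset.sum_sub_distrib]; abel
    _ = x n - (transport B 0 n (x 0) + ∑ m ∈ Finset.range n, transport B (m + 1) (n - 1 - m) (b m)) := by rw [← hA]
    _ = ∑ m ∈ Finset.range n, transport B (m + 1) (n - 1 - m) (A m (x m) - B m (x m)) := by
        rw [hB]; abel

/-- [folklore] **THE HYBRID SPLIT, CELL FORM**: `x_n = T^{hyb}_n + Σ_{m<n} 𝒯^B(m+1, n−1−m) cell_m` with `T^{hyb}_n := 𝒯^B(0,n) x_0 + Σ_{m<n} 𝒯^B(m+1,n−1−m) b_m`
(p2's hybrid carrier). -/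
theorem eq_hyb_add_sum_transport_cell (hP0 : P 0) (hPadd : ∀ x y, P x → P y → P (x + y)) (hPsub : ∀ x y, P x → P y → P (x - y))
    (hAP : ∀ j x, P x → P (A j x)) (hBP : ∀ j x, P x → P (B j x)) (hBadd : ∀ j x y, P x → P y → B j (x + y) = B j x + B j y)
    {x b : ℕ → E} (hx0 : P (x 0)) (hb : ∀ j, P (b j)) (hrec : ∀ j, x (j + 1) = A j (x j) + b j) (n : ℕ) :
    x n = (transport B 0 n (x 0) + ∑ m ∈ Finset.range n, transport B (m + 1) (n - 1 - m) (b m)) +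
      ∑ m ∈ Finset.range n, transport B (m + 1) (n - 1 - m) (A m (x m) - B m (x m)) :=
  eq_transportB_add_sum_add_sum_cell hP0 hPadd hPsub hAP hBP hBadd hx0 hb hrec n

/-- [folklore] **THE DIFFERENCE TOWER THROUGH THE SHIFTED UNDRESSED TRANSPORT** (road W3's END #2 `hsplit` shape for the dressed tower):
`x_{n+1} − x_n = 𝒯^B(1,n)(x_1 − x_0) + Σ_{m<n} 𝒯^B(m+2, n−1−m) [ (B_{m+1} x_m − B_m x_m) + ((b_{m+1} + cell_{m+1}) − (b_m + cell_m)) ]`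
(leaf-01's `AffineUnroll.diff_eq_transport_add_sum` for `B` on `rec_of_cell`). -/
theorem diff_eq_transportB_add_sum_cell (hP0 : P 0) (hPadd : ∀ x y, P x → P y → P (x + y)) (hPsub : ∀ x y, P x → P y → P (x - y))
    (hAP : ∀ j x, P x → P (A j x)) (hBP : ∀ j x, P x → P (B j x)) (hBadd : ∀ j x y, P x → P y → B j (x + y) = B j x + B j y)
    {x b : ℕ → E} (hx0 : P (x 0)) (hb : ∀ j, P (b j)) (hrec : ∀ j, x (j + 1) = A j (x j) + b j) (n : ℕ) :
    x (n + 1) - x n = transport B 1 n (x 1 - x 0) +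
      ∑ m ∈ Finset.range n, transport B (m + 2) (n - 1 - m)
        ((B (m + 1) (x m) - B m (x m)) + ((b (m + 1) + (A (m + 1) (x (m + 1)) - B (m + 1) (x (m + 1)))) - (b m + (A m (x m) - B m (x m))))) :=
  diff_eq_transport_add_sum (A := B) (P := P) hP0 hPadd hPsub hBP hBadd hx0 (cellSource_mem hPadd hPsub hAP hBP hx0 hb hrec)
    (rec_of_cell B hrec) n

/-- [folklore] The forcing of the difference tower split into road W3's forcing and the CELL DIFFERENCE:
`(B_{m+1} x_m − B_m x_m) + ((b_{m+1} + cell_{m+1}) − (b_m + cell_m)) = [(B_{m+1} x_m − B_m x_m) + (b_{m+1} − b_m)] + (cell_{m+1} − cell_m)`. -/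
theorem forcing_cell_split (x b : ℕ → E) (m : ℕ) :
    (B (m + 1) (x m) - B m (x m)) + ((b (m + 1) + (A (m + 1) (x (m + 1)) - B (m + 1) (x (m + 1)))) - (b m + (A m (x m) - B m (x m)))) =
      ((B (m + 1) (x m) - B m (x m)) + (b (m + 1) - b m)) +
        ((A (m + 1) (x (m + 1)) - B (m + 1) (x (m + 1))) - (A m (x m) - B m (x m))) := by
  abel

/-! ### §1b The DEVIATION tower of two affine towers (the OWNER g23's (R-DEV), ruling R-gan24p1-g23-1) -/

/-- [folklore] **THE DEVIATION OF TWO AFFINE TOWERS IS AN AFFINE TOWER FOR THE FIRST TRANSPORT, FORCED ON THE SECOND TOWER ONLY**: if `x_{j+1} = A_j x_j + b_j`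
(dressed) and `y_{j+1} = B_j y_j + b′_j` (undressed), with `A_j` additive on a class containing both towers, then
`x_{j+1} − y_{j+1} = A_j (x_j − y_j) + ((A_j y_j − B_j y_j) + (b_j − b′_j))` — the forcing `g′_j := (A_j − B_j) y_j + (b_j − b′_j)` references the UNDRESSED member `y_j` and
the source difference only (the OWNER's `g′_j = 𝒜^B_j((𝔇 − 1) T_j) + (b̃_j − b_j)` once `(A_j − B_j) y_j` is rewritten by `T2HybridCellsComb.cell_comb_eq`'s pattern). -/
theorem dev_rec (hPsub : ∀ x y, P x → P y → P (x - y)) (hAadd : ∀ j x y, P x → P y → A j (x + y) = A j x + A j y)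
    {x y b b' : ℕ → E} (hxP : ∀ j, P (x j)) (hyP : ∀ j, P (y j))
    (hx : ∀ j, x (j + 1) = A j (x j) + b j) (hy : ∀ j, y (j + 1) = B j (y j) + b' j) (j : ℕ) :
    x (j + 1) - y (j + 1) = A j (x j - y j) + ((A j (y j) - B j (y j)) + (b j - b' j)) := by
  have hsplit : A j (x j) = A j (x j - y j) + A j (y j) := by
    rw [← hAadd j _ _ (hPsub _ _ (hxP j) (hyP j)) (hyP j), sub_add_cancel]
  rw [hx j, hy j, hsplit]
  abel

/-- [folklore] The same deviation as an affine tower for the SECOND transport, forced through the dressed member: `x_{j+1} − y_{j+1} = B_j (x_j − y_j) + ((A_j x_j − B_j x_j) + (b_j − b′_j))`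
(`B_j` additive on the class; the forcing is the CELL of the dressed member plus the source difference — circular for estimates, recorded for completeness). -/
theorem dev_rec' (hPsub : ∀ x y, P x → P y → P (x - y)) (hBadd : ∀ j x y, P x → P y → B j (x + y) = B j x + B j y)
    {x y b b' : ℕ → E} (hxP : ∀ j, P (x j)) (hyP : ∀ j, P (y j))
    (hx : ∀ j, x (j + 1) = A j (x j) + b j) (hy : ∀ j, y (j + 1) = B j (y j) + b' j) (j : ℕ) :
    x (j + 1) - y (j + 1) = B j (x j - y j) + ((A j (x j) - B j (x j)) + (b j - b' j)) := by
  have hsplit : B j (y j) = B j (x j) - B j (x j - y j) := by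
    rw [← map_sub_of_add hPsub (hBadd j) (hxP j) (hPsub _ _ (hxP j) (hyP j)), sub_sub_cancel]
  rw [hx j, hy j, hsplit]
  abel

/-- [folklore] **THE DEVIATION TOWER UNROLLED THROUGH THE DRESSED TRANSPORT** (leaf-01's `AffineUnroll.eq_transport_add_sum` on `dev_rec`; both towers started and sourced in the
class): `x_n − y_n = 𝒯^A(0,n)(x_0 − y_0) + Σ_{m<n} 𝒯^A(m+1, n−1−m) ((A_m y_m − B_m y_m) + (b_m − b′_m))` — with `x_0 = y_0` the first term is `𝒯^A(0,n) 0 = 0` (`transport_map_zero`). -/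
theorem dev_eq_transport_add_sum (hP0 : P 0) (hPadd : ∀ x y, P x → P y → P (x + y)) (hPsub : ∀ x y, P x → P y → P (x - y))
    (hAP : ∀ j x, P x → P (A j x)) (hBP : ∀ j x, P x → P (B j x)) (hAadd : ∀ j x y, P x → P y → A j (x + y) = A j x + A j y)
    {x y b b' : ℕ → E} (hx0 : P (x 0)) (hy0 : P (y 0)) (hb : ∀ j, P (b j)) (hb' : ∀ j, P (b' j))
    (hx : ∀ j, x (j + 1) = A j (x j) + b j) (hy : ∀ j, y (j + 1) = B j (y j) + b' j) (n : ℕ) :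
    x n - y n = transport A 0 n (x 0 - y 0) +
      ∑ m ∈ Finset.range n, transport A (m + 1) (n - 1 - m) ((A m (y m) - B m (y m)) + (b m - b' m)) := by
  have hxP : ∀ j, P (x j) := mem_of_rec hPadd hAP hx0 hb hx
  have hyP : ∀ j, P (y j) := mem_of_rec hPadd hBP hy0 hb' hy
  have hg : ∀ j, P ((A j (y j) - B j (y j)) + (b j - b' j)) := fun j =>
    hPadd _ _ (hPsub _ _ (hAP _ _ (hyP j)) (hBP _ _ (hyP j))) (hPsub _ _ (hb j) (hb' j))
  exact eq_transport_add_sum (A := A) (P := P) (x := fun j => x j - y j) hP0 hPadd hAP hAadd (hPsub _ _ hx0 hy0) hg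
    (fun j => dev_rec hPsub hAadd hxP hyP hx hy j) n

/-- [folklore] **THE DEVIATION TOWER FROM A COMMON START**: `x_0 = y_0` ⇒ `x_n − y_n = Σ_{m<n} 𝒯^A(m+1, n−1−m) g′_m` — the OWNER's (R-DEV) carrier: the charged sector rides the
undressed tower `y`, the deviation is transported by the DRESSED composites and forced by `g′` alone. -/
theorem dev_eq_sum_transport_of_eq_zero (hP0 : P 0) (hPadd : ∀ x y, P x → P y → P (x + y)) (hPsub : ∀ x y, P x → P y → P (x - y))
    (hAP : ∀ j x, P x → P (A j x)) (hBP : ∀ j x, P x → P (B j x)) (hAadd : ∀ j x y, P x → P y → A j (x + y) = A j x + A j y)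
    {x y b b' : ℕ → E} (hx0 : P (x 0)) (h0 : x 0 = y 0) (hb : ∀ j, P (b j)) (hb' : ∀ j, P (b' j))
    (hx : ∀ j, x (j + 1) = A j (x j) + b j) (hy : ∀ j, y (j + 1) = B j (y j) + b' j) (n : ℕ) :
    x n - y n = ∑ m ∈ Finset.range n, transport A (m + 1) (n - 1 - m) ((A m (y m) - B m (y m)) + (b m - b' m)) := by
  rw [dev_eq_transport_add_sum hP0 hPadd hPsub hAP hBP hAadd hx0 (h0 ▸ hx0) hb hb' hx hy n, h0, sub_self,
    transport_map_zero hP0 hAadd, zero_add]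

end Generic

/-! ## §2 Generic `d`: road «W3»'s two ENDs with a second (cell) source family — PER-LEVEL rows, no uniform contact hypothesis -/

section Ends

variable {d : ℕ}

/-- NOT IN PRINT; OUR BOOKKEEPING ([folklore] the row OWNER's `WSlotT2OfPieces.shape_of_rows` with one more level sum).  **END #1 WITH CELLS.**  If
`T n = P 0 n (T 0) + Σ_{i<n} P (i+1) (n−1−i) (b i) + Σ_{i<n} P (i+1) (n−1−i) (c i)` (§1 `eq_transportB_add_sum_add_sum_cell` for the dressed tower, `P` = the
UNDRESSED transport), the transport carries road W3's rows `hTmarg` ∕ `hTirr` (at `d = 3`: `TransportRows.transport_rows_three`, TREE), the sources `b` AND the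
cells `c` are zero-mode-free with uniform shape and first moment (`hb hZ` ∕ `hc hZc` — the cell rows are CT-W2∕W3's deliverable), and `h0`, then
`LocStencil₂ (T n) (CT·C₀ + CT′·(Cb + Cc)·(1−ρ)⁻¹) δT` for every `n`. -/
theorem shape_of_cell_rows (T b c : ℕ → Fin (d + 1) → (Fin (d + 1) → ℤ) → Fin (d + 1) → (Fin (d + 1) → ℤ) → MKer (d + 1) (Fib d))
    (P : ℕ → ℕ → (Fin (d + 1) → (Fin (d + 1) → ℤ) → Fin (d + 1) → (Fin (d + 1) → ℤ) → MKer (d + 1) (Fib d)) →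
      Fin (d + 1) → (Fin (d + 1) → ℤ) → Fin (d + 1) → (Fin (d + 1) → ℤ) → MKer (d + 1) (Fib d))
    (Zfree : (Fin (d + 1) → (Fin (d + 1) → ℤ) → Fin (d + 1) → (Fin (d + 1) → ℤ) → MKer (d + 1) (Fib d)) → Prop)
    (mom : (Fin (d + 1) → (Fin (d + 1) → ℤ) → Fin (d + 1) → (Fin (d + 1) → ℤ) → MKer (d + 1) (Fib d)) → ℝ)
    {δin δT CT CT' ρ Cb Cc C₀ : ℝ} (hCT' : 0 ≤ CT') (hρ0 : 0 ≤ ρ) (hρ1 : ρ < 1)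
    (hsplit : ∀ n, T n = P 0 n (T 0) + ∑ i ∈ Finset.range n, P (i + 1) (n - 1 - i) (b i) + ∑ i ∈ Finset.range n, P (i + 1) (n - 1 - i) (c i))
    (hTmarg : ∀ (m k : ℕ) (X : Fin (d + 1) → (Fin (d + 1) → ℤ) → Fin (d + 1) → (Fin (d + 1) → ℤ) → MKer (d + 1) (Fib d)) (C : ℝ), 0 ≤ C →
      LocStencil₂ X C δin → LocStencil₂ (P m k X) (CT * C) δT)
    (hTirr : ∀ (m k : ℕ) (X : Fin (d + 1) → (Fin (d + 1) → ℤ) → Fin (d + 1) → (Fin (d + 1) → ℤ) → MKer (d + 1) (Fib d)) (C : ℝ), 0 ≤ C →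
      LocStencil₂ X C δin → Zfree X → mom X ≤ C → LocStencil₂ (P m k X) (CT' * C * ρ ^ k) δT)
    (hb : ∀ m, LocStencil₂ (b m) Cb δin ∧ mom (b m) ≤ Cb) (hZ : ∀ m, Zfree (b m))
    (hc : ∀ m, LocStencil₂ (c m) Cc δin ∧ mom (c m) ≤ Cc) (hZc : ∀ m, Zfree (c m))
    (h0 : LocStencil₂ (T 0) C₀ δin) (n : ℕ) :
    LocStencil₂ (T n) (CT * C₀ + CT' * (Cb + Cc) * (1 - ρ)⁻¹) δT := by
  have hC₀ : 0 ≤ C₀ := h0.nonneg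
  have hCb : 0 ≤ Cb := (hb 0).1.nonneg
  have hCc : 0 ≤ Cc := (hc 0).1.nonneg
  rw [hsplit n]
  have h1 : LocStencil₂ (∑ i ∈ Finset.range n, P (i + 1) (n - 1 - i) (b i)) (CT' * Cb * (1 - ρ)⁻¹) δT := by
    refine locStencil₂_mono (locStencil₂_sum (Finset.range n) _ (fun i => CT' * Cb * ρ ^ (n - 1 - i))
      fun i _ => hTirr (i + 1) (n - 1 - i) (b i) Cb hCb (hb i).1 (hZ i) (hb i).2) ?_
    rw [← Finset.mul_sum]
    exact mul_le_mul_of_nonneg_left (geom_reflect_sum_le hρ0 hρ1 n) (mul_nonneg hCT' hCb)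
  have h2 : LocStencil₂ (∑ i ∈ Finset.range n, P (i + 1) (n - 1 - i) (c i)) (CT' * Cc * (1 - ρ)⁻¹) δT := by
    refine locStencil₂_mono (locStencil₂_sum (Finset.range n) _ (fun i => CT' * Cc * ρ ^ (n - 1 - i))
      fun i _ => hTirr (i + 1) (n - 1 - i) (c i) Cc hCc (hc i).1 (hZc i) (hc i).2) ?_
    rw [← Finset.mul_sum]
    exact mul_le_mul_of_nonneg_left (geom_reflect_sum_le hρ0 hρ1 n) (mul_nonneg hCT' hCc)
  have h := locStencil₂_add (locStencil₂_add (hTmarg 0 n (T 0) C₀ hC₀ h0) h1) h2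
  refine locStencil₂_mono h (le_of_eq ?_)
  ring

/-- NOT IN PRINT; OUR BOOKKEEPING ([folklore] the row OWNER's `WSlotT2OfPieces.rate_of_rows` with one more forcing family).  **END #2 WITH CELLS** (generic tower of
differences): if `D n = P 0 n (D 0) + Σ_{i<n} P (i+1) (n−1−i) (f i) + Σ_{i<n} P (i+1) (n−1−i) (g i)` (§1 `diff_eq_transportB_add_sum_cell` + `forcing_cell_split` +
additivity of the shifted transport: `f` = road W3's forcing, `g` = the CELL DIFFERENCES), the transport is irrelevant on zero-mode-free tables (`hTirr`), both forcings
are zero-mode-free of geometric size (`hf hZf` at `Cf·θ^m`, `hg hZg` at `Cg·θ^m` — the latter CT-W4's deliverable), and `D 0` is zero-mode-free (`h0 hZ0`), then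
`D n` is a `LocStencil₂` family with constant `c·ϑ^n`, some `c ≥ 0`, `ϑ ∈ (0,1)`. -/
theorem rate_of_cell_rows (D f g : ℕ → Fin (d + 1) → (Fin (d + 1) → ℤ) → Fin (d + 1) → (Fin (d + 1) → ℤ) → MKer (d + 1) (Fib d))
    (P : ℕ → ℕ → (Fin (d + 1) → (Fin (d + 1) → ℤ) → Fin (d + 1) → (Fin (d + 1) → ℤ) → MKer (d + 1) (Fib d)) →
      Fin (d + 1) → (Fin (d + 1) → ℤ) → Fin (d + 1) → (Fin (d + 1) → ℤ) → MKer (d + 1) (Fib d))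
    (Zfree : (Fin (d + 1) → (Fin (d + 1) → ℤ) → Fin (d + 1) → (Fin (d + 1) → ℤ) → MKer (d + 1) (Fib d)) → Prop)
    (mom : (Fin (d + 1) → (Fin (d + 1) → ℤ) → Fin (d + 1) → (Fin (d + 1) → ℤ) → MKer (d + 1) (Fib d)) → ℝ)
    {δin δT CT' ρ θ Cf Cg C₀ : ℝ} (hCT' : 0 ≤ CT') (hρ0 : 0 ≤ ρ) (hρ1 : ρ < 1) (hθ0 : 0 ≤ θ) (hθ1 : θ < 1)
    (hsplit : ∀ n, D n = P 0 n (D 0) + ∑ i ∈ Finset.range n, P (i + 1) (n - 1 - i) (f i) + ∑ i ∈ Finset.range n, P (i + 1) (n - 1 - i) (g i))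
    (hTirr : ∀ (m k : ℕ) (X : Fin (d + 1) → (Fin (d + 1) → ℤ) → Fin (d + 1) → (Fin (d + 1) → ℤ) → MKer (d + 1) (Fib d)) (C : ℝ), 0 ≤ C →
      LocStencil₂ X C δin → Zfree X → mom X ≤ C → LocStencil₂ (P m k X) (CT' * C * ρ ^ k) δT)
    (hf : ∀ m, LocStencil₂ (f m) (Cf * θ ^ m) δin ∧ mom (f m) ≤ Cf * θ ^ m) (hZf : ∀ m, Zfree (f m))
    (hg : ∀ m, LocStencil₂ (g m) (Cg * θ ^ m) δin ∧ mom (g m) ≤ Cg * θ ^ m) (hZg : ∀ m, Zfree (g m))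
    (h0 : LocStencil₂ (D 0) C₀ δin ∧ mom (D 0) ≤ C₀) (hZ0 : Zfree (D 0)) :
    ∃ c ϑ : ℝ, 0 ≤ c ∧ 0 < ϑ ∧ ϑ < 1 ∧ ∀ n, LocStencil₂ (D n) (c * ϑ ^ n) δT := by
  have hC₀ : 0 ≤ C₀ := h0.1.nonneg
  have hCf : 0 ≤ Cf := by simpa using (hf 0).1.nonneg
  have hCg : 0 ≤ Cg := by simpa using (hg 0).1.nonneg
  set μ : ℝ := max ρ θ with hμ
  have hμ0 : 0 ≤ μ := le_max_of_le_left hρ0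
  have hμ1 : μ < 1 := max_lt hρ1 hθ1
  obtain ⟨c₀, ϑ, hc₀, hϑ0, hϑ1, hμϑ, hdom⟩ := exists_geom_dominate hμ0 hμ1
  refine ⟨CT' * C₀ + CT' * (Cf + Cg) * c₀ * ϑ⁻¹, ϑ, by positivity, hϑ0, hϑ1, fun n => ?_⟩
  -- the raw bound
  have hraw : LocStencil₂ (D n) (CT' * C₀ * ρ ^ n + ∑ i ∈ Finset.range n, CT' * (Cf * θ ^ i) * ρ ^ (n - 1 - i) +
      ∑ i ∈ Finset.range n, CT' * (Cg * θ ^ i) * ρ ^ (n - 1 - i)) δT := by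
    rw [hsplit n]
    exact locStencil₂_add (locStencil₂_add (hTirr 0 n (D 0) C₀ hC₀ h0.1 hZ0 h0.2) (locStencil₂_sum (Finset.range n) _
      (fun i => CT' * (Cf * θ ^ i) * ρ ^ (n - 1 - i))
      fun i _ => hTirr (i + 1) (n - 1 - i) (f i) (Cf * θ ^ i) (by positivity) (hf i).1 (hZf i) (hf i).2))
      (locStencil₂_sum (Finset.range n) _ (fun i => CT' * (Cg * θ ^ i) * ρ ^ (n - 1 - i))
      fun i _ => hTirr (i + 1) (n - 1 - i) (g i) (Cg * θ ^ i) (by positivity) (hg i).1 (hZg i) (hg i).2)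
  refine locStencil₂_mono hraw ?_
  have h1 : CT' * C₀ * ρ ^ n ≤ CT' * C₀ * ϑ ^ n :=
    mul_le_mul_of_nonneg_left (pow_le_pow_left₀ hρ0 ((le_max_left ρ θ).trans hμϑ) n) (mul_nonneg hCT' hC₀)
  have hconv : ∑ i ∈ Finset.range n, ρ ^ (n - 1 - i) * θ ^ i ≤ c₀ * ϑ⁻¹ * ϑ ^ n := by
    refine (conv_sum_le hρ0 hθ0 n).trans ?_
    rcases n with _ | m
    · simp only [Nat.cast_zero, zero_mul]; positivity
    · rw [Nat.add_sub_cancel, pow_succ]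
      calc ((m + 1 : ℕ) : ℝ) * μ ^ m = ((m : ℝ) + 1) * μ ^ m := by push_cast; ring
        _ ≤ c₀ * ϑ ^ m := hdom m
        _ = c₀ * ϑ⁻¹ * (ϑ ^ m * ϑ) := by field_simp
  have hsumC : ∀ C : ℝ, 0 ≤ C → ∑ i ∈ Finset.range n, CT' * (C * θ ^ i) * ρ ^ (n - 1 - i) ≤ CT' * C * c₀ * ϑ⁻¹ * ϑ ^ n := fun C hC => by
    have hsum : ∑ i ∈ Finset.range n, CT' * (C * θ ^ i) * ρ ^ (n - 1 - i) =
        CT' * C * ∑ i ∈ Finset.range n, ρ ^ (n - 1 - i) * θ ^ i := by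
      rw [Finset.mul_sum]; refine Finset.sum_congr rfl fun i _ => by ring
    rw [hsum]
    calc CT' * C * ∑ i ∈ Finset.range n, ρ ^ (n - 1 - i) * θ ^ i ≤ CT' * C * (c₀ * ϑ⁻¹ * ϑ ^ n) :=
          mul_le_mul_of_nonneg_left hconv (mul_nonneg hCT' hC)
      _ = CT' * C * c₀ * ϑ⁻¹ * ϑ ^ n := by ring
  calc CT' * C₀ * ρ ^ n + ∑ i ∈ Finset.range n, CT' * (Cf * θ ^ i) * ρ ^ (n - 1 - i) +
        ∑ i ∈ Finset.range n, CT' * (Cg * θ ^ i) * ρ ^ (n - 1 - i)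
      ≤ CT' * C₀ * ϑ ^ n + CT' * Cf * c₀ * ϑ⁻¹ * ϑ ^ n + CT' * Cg * c₀ * ϑ⁻¹ * ϑ ^ n :=
        add_le_add (add_le_add h1 (hsumC Cf hCf)) (hsumC Cg hCg)
    _ = (CT' * C₀ + CT' * (Cf + Cg) * c₀ * ϑ⁻¹) * ϑ ^ n := by ring

end Ends

end Summit.QuantumFields.BalabanUV.Beta.GAN24.T2HybridCells

end
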